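import Literature.NumberTheory.LFunctions.CertifiedDirichletLTuringHolds
import HarnessLib

/-!
# Turing's method for Dirichlet `L`-functions: the two-sided bound `|∫S(t,χ)dt + ∫S(t,χ̄)dt|`

Trudgian 2011, Theorem 3.8 bounds `|∫_{t₁}^{t₂} S(t,χ) dt|`; Booker 2006, Remark 4.7: "there is no
assumption on the order of `t₁` and `t₂`, so one obtains a lower bound as well by reversing their
roles".  The files `CertifiedDirichletLTuringAssembled.lean` / `…Holds.lean` prove the upper bound for
the pair `∫S_χ + ∫S_χ̄`; here the roles of `t₁`, `t₂` are reversed (Lemma 3.6 at `t₁`, Lemma 3.7 at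
`t₂`, and `log(Qt₁/2π) ≤ log(Qt₂/2π)` with the non-negative weight `b₁`) to get the lower bound, hence
the printed absolute-value shape — unconditionally (Booker's inequality = the tree's
`Trudgian2011_lemma_2_10_holds`):

* `TuringDirichlet.abs_integral_lfunctionArgS_pair_le` — for a primitive `χ` modulo `Q > 1`,
  `1 < c ≤ 5/4`, `½ < d ≤ 1`, `1 ≤ t₀ < t₁ ≤ t₂` (non-ordinates for `χ`, `χ̄`),
  `π |∫_{t₁}^{t₂} S(t,χ)dt + ∫_{t₁}^{t₂} S(t,χ̄)dt| ≤ 2(a₁ + a₂) + 2(b₁ + b₂) log(Qt₂/2π)`.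
* `TuringDirichlet.abs_integral_lfunctionArgS_pair_le_numeric` — granted the certified `ζ` computation
  `trudgianCheck = true`: for `50 < t₁ ≤ t₂`,
  `|∫_{t₁}^{t₂} S(t,χ)dt + ∫_{t₁}^{t₂} S(t,χ̄)dt| ≤ 2·(2.26 + 0.0642 log(qt₂/2π))`
  (printed single-character comparators: Rumely `1.8397 + 0.1242 log`, Trudgian `1.975 + 0.084 log`).

## References
* T. S. Trudgian, Improvements to Turing's method, Math. Comp. 80 (2011), §3.4 Theorem 3.8, §3.5.
  [Trudgian2011]
* A. R. Booker, Experiment. Math. 15 (2006), Remark 4.7. [Booker2006]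
-/

noncomputable section

open Complex Set MeasureTheory intervalIntegral Filter Topology
open scoped Real

namespace Literature.NumberTheory.LFunctions

open DirichletTheta DirichletCharacter ExplicitPsiChar Trudgian2011Dirichlet TrudgianNumerics

namespace TuringDirichlet

variable {q : ℕ} [NeZero q] {χ : DirichletCharacter ℂ q}

omit [NeZero q] in
/-- The inverse of a primitive character is primitive. [folklore] -/
private theorem isPrimitive_inv₄ (hχ : χ.IsPrimitive) : χ⁻¹.IsPrimitive := by
  rw [DirichletCharacter.isPrimitive_def, DirichletCharacter.conductor_inv]; exact hχ

omit [NeZero q] in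
/-- `log(Qt/2π) = log Q + log t − log 2 − log π`. [folklore] -/
private theorem log_qt_eq' (hq : 0 < (q : ℝ)) {t : ℝ} (ht : 0 < t) :
    Real.log (q * t / (2 * π)) = Real.log q + Real.log t - Real.log 2 - Real.log π := by
  rw [Real.log_div (by positivity) (by positivity), Real.log_mul hq.ne' ht.ne',
    Real.log_mul two_ne_zero Real.pi_ne_zero]
  ring

/-- `log 4 ≥ 1` (`e < 4`). [folklore] -/
private theorem one_le_log_four' : 1 ≤ Real.log 4 := by
  rw [Real.le_log_iff_exp_le (by norm_num)]
  have := Real.exp_one_lt_three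
  linarith

/-- **The reversed (lower) bound** (Booker 2006 Remark 4.7: "one obtains a lower bound as well by
reversing their roles"): in the setting of `pi_mul_integral_lfunctionArgS_pair_le'`,
`−π(∫_{t₁}^{t₂} S(t,χ)dt + ∫_{t₁}^{t₂} S(t,χ̄)dt) ≤ 2(a₁ + a₂) + 2(b₁ + b₂) log(Qt₂/2π)` (Lemma 3.6 at
`t₁`, Lemma 3.7 at `t₂`). [cite: Booker2006, Remark 4.7] [cite: Trudgian2011, §3.4 Theorem 3.8] -/
theorem neg_pi_mul_integral_lfunctionArgS_pair_le (hq : 1 < q) (hχ : χ.IsPrimitive)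
    {c d t₀ t₁ t₂ : ℝ} (hc1 : 1 < c) (hc : c ≤ 5 / 4) (hd : 1 / 2 < d) (hd1 : d ≤ 1) (ht₀ : 1 ≤ t₀)
    (h01 : t₀ < t₁) (h12 : t₁ ≤ t₂)
    (hz₁ : ∀ ρ ∈ charNontrivialZeros χ, ρ.im ≠ t₁) (hz₁' : ∀ ρ ∈ charNontrivialZeros χ⁻¹, ρ.im ≠ t₁)
    (hz₂ : ∀ ρ ∈ charNontrivialZeros χ, ρ.im ≠ t₂) (hz₂' : ∀ ρ ∈ charNontrivialZeros χ⁻¹, ρ.im ≠ t₂) :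
    -(π * ((∫ t in t₁..t₂, lfunctionArgS χ t) + ∫ t in t₁..t₂, lfunctionArgS χ⁻¹ t)) ≤
      2 * ((729 / (2048 * t₀ ^ 2) + (c - 1 / 2) * logZeta c + ∫ σ in Ioi c, logZeta σ) +
          (d ^ 2 * Real.log 4 *
              ((2 * (deriv riemannZeta (2 * (1 / 2 + d) : ℝ) / riemannZeta (2 * (1 / 2 + d) : ℝ)).re -
                  (deriv riemannZeta (1 / 2 + d : ℝ) / riemannZeta (1 / 2 + d : ℝ)).re) +
                turingEps' t₀) +
            d ^ 2 * turingEps t₀ - turingI d)) +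
        2 * ((c - 1 / 2) ^ 2 / 4 + d ^ 2 / 2 * (Real.log 4 - 1)) * Real.log (q * t₂ / (2 * π)) := by
  have hq1 : q ≠ 1 := by omega
  have hqR : (0 : ℝ) < q := by exact_mod_cast (show 0 < q by omega)
  have h1 : χ ≠ 1 := SelbergDirichlet.ne_one_of_isPrimitive hq1 hχ
  have hχ' : χ⁻¹.IsPrimitive := isPrimitive_inv₄ hχ
  have ht₀0 : 0 < t₀ := by linarith
  have ht₁0 : 0 < t₁ := by linarith
  have ht₂ : 1 ≤ t₂ := by linarith
  have ht₂0 : 0 < t₂ := by linarith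
  -- Littlewood for `χ` and `χ̄`
  have hLw := pi_mul_integral_lfunctionArgS_eq hχ hq h12 hz₁ hz₂
  have hLw' := pi_mul_integral_lfunctionArgS_eq hχ' hq h12 hz₁' hz₂'
  -- Lemma 3.6 at `t₁`
  have hU := trudgian2011_lemma36 hq hχ hc1 hc ht₀0 h01 hz₁
  have hU' := trudgian2011_lemma36 hq hχ' hc1 hc ht₀0 h01 hz₁'
  -- Lemma 3.7 (pair) at `t₂`
  have hL := neg_setIntegral_log_norm_LFunction_pair_le Trudgian2011_lemma_2_10_holds hq hχ hd hd1 ht₂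
    hz₂ hz₂'
  -- monotonicity of the error terms and of the logarithm
  have hε := turingEps_le ht₀0 (h01.le.trans h12)
  have hε' := turingEps'_le ht₀0 (h01.le.trans h12)
  have hlog4 : 0 ≤ d ^ 2 * Real.log 4 := by
    have := one_le_log_four'; positivity
  have hd2 : 0 ≤ d ^ 2 := sq_nonneg d
  have hb₁ : 0 ≤ (c - 1 / 2) ^ 2 / 4 := by positivity
  have hlog₁ := log_qt_eq' hqR ht₁0
  have hlog₂ := log_qt_eq' hqR ht₂0
  have hmono : Real.log (q * t₁ / (2 * π)) ≤ Real.log (q * t₂ / (2 * π)) := by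
    refine Real.log_le_log (by positivity) ?_
    gcongr
  have hm1 := mul_le_mul_of_nonneg_left hε' hlog4
  have hm2 := mul_le_mul_of_nonneg_left hε hd2
  have hm3 := mul_le_mul_of_nonneg_left hmono hb₁
  rw [mul_add, hLw, hLw']
  rw [hlog₁] at hU hU' hm3
  rw [hlog₂] at hm3 ⊢
  linarith

/-- **Trudgian 2011, Theorem 3.8, pair form, two-sided — unconditional** (the printed absolute-value
shape; Booker 2006 Remark 4.7): for a primitive `χ` modulo `Q > 1`, `1 < c ≤ 5/4`, `½ < d ≤ 1`,
`1 ≤ t₀ < t₁ ≤ t₂`, `t₁`, `t₂` ordinates of no zero of `L(s,χ)` or `L(s,χ̄)` with `0 < Re s < 1`,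
`π |∫_{t₁}^{t₂} S(t,χ)dt + ∫_{t₁}^{t₂} S(t,χ̄)dt| ≤ 2(a₁ + a₂) + 2(b₁ + b₂) log(Qt₂/2π)`, constants as in
`pi_mul_integral_lfunctionArgS_pair_le`. [cite: Trudgian2011, §3.4 Theorem 3.8]
[cite: Booker2006, Remark 4.7] -/
theorem abs_integral_lfunctionArgS_pair_le (hq : 1 < q) (hχ : χ.IsPrimitive)
    {c d t₀ t₁ t₂ : ℝ} (hc1 : 1 < c) (hc : c ≤ 5 / 4) (hd : 1 / 2 < d) (hd1 : d ≤ 1) (ht₀ : 1 ≤ t₀)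
    (h01 : t₀ < t₁) (h12 : t₁ ≤ t₂)
    (hz₁ : ∀ ρ ∈ charNontrivialZeros χ, ρ.im ≠ t₁) (hz₁' : ∀ ρ ∈ charNontrivialZeros χ⁻¹, ρ.im ≠ t₁)
    (hz₂ : ∀ ρ ∈ charNontrivialZeros χ, ρ.im ≠ t₂) (hz₂' : ∀ ρ ∈ charNontrivialZeros χ⁻¹, ρ.im ≠ t₂) :
    π * |(∫ t in t₁..t₂, lfunctionArgS χ t) + ∫ t in t₁..t₂, lfunctionArgS χ⁻¹ t| ≤
      2 * ((729 / (2048 * t₀ ^ 2) + (c - 1 / 2) * logZeta c + ∫ σ in Ioi c, logZeta σ) +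
          (d ^ 2 * Real.log 4 *
              ((2 * (deriv riemannZeta (2 * (1 / 2 + d) : ℝ) / riemannZeta (2 * (1 / 2 + d) : ℝ)).re -
                  (deriv riemannZeta (1 / 2 + d : ℝ) / riemannZeta (1 / 2 + d : ℝ)).re) +
                turingEps' t₀) +
            d ^ 2 * turingEps t₀ - turingI d)) +
        2 * ((c - 1 / 2) ^ 2 / 4 + d ^ 2 / 2 * (Real.log 4 - 1)) * Real.log (q * t₂ / (2 * π)) := by
  have hup := pi_mul_integral_lfunctionArgS_pair_le' hq hχ hc1 hc hd hd1 ht₀ h01 h12 hz₁ hz₁' hz₂ hz₂'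
  have hlo := neg_pi_mul_integral_lfunctionArgS_pair_le hq hχ hc1 hc hd hd1 ht₀ h01 h12 hz₁ hz₁' hz₂ hz₂'
  rcases le_or_gt 0 ((∫ t in t₁..t₂, lfunctionArgS χ t) + ∫ t in t₁..t₂, lfunctionArgS χ⁻¹ t) with h | h
  · rw [abs_of_nonneg h]; exact hup
  · rw [abs_of_neg h, mul_neg]; exact hlo

/-- **Two-sided numerical pair bound, granted the certified `ζ` computation**: for a primitive `χ`
modulo `q > 1` and `50 < t₁ ≤ t₂` (ordinates of no zero of `L(s,χ)L(s,χ̄)` in the critical strip),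
`|∫_{t₁}^{t₂} S(t,χ) dt + ∫_{t₁}^{t₂} S(t,χ̄) dt| ≤ 2·(2.26 + 0.0642·log(qt₂/2π))`.
[cite: Trudgian2011, §3.5 and Theorem 3.3] [cite: Booker2006, Remark 4.7] -/
theorem abs_integral_lfunctionArgS_pair_le_numeric (hcheck : trudgianCheck = true) (hq : 1 < q)
    (hχ : χ.IsPrimitive) {t₁ t₂ : ℝ} (h01 : 50 < t₁) (h12 : t₁ ≤ t₂)
    (hz₁ : ∀ ρ ∈ charNontrivialZeros χ, ρ.im ≠ t₁) (hz₁' : ∀ ρ ∈ charNontrivialZeros χ⁻¹, ρ.im ≠ t₁)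
    (hz₂ : ∀ ρ ∈ charNontrivialZeros χ, ρ.im ≠ t₂) (hz₂' : ∀ ρ ∈ charNontrivialZeros χ⁻¹, ρ.im ≠ t₂) :
    |(∫ t in t₁..t₂, lfunctionArgS χ t) + ∫ t in t₁..t₂, lfunctionArgS χ⁻¹ t| ≤
      2 * (2.26 + 0.0642 * Real.log (q * t₂ / (2 * π))) := by
  have hup := integral_lfunctionArgS_pair_le_numeric hcheck hq hχ h01 h12 hz₁ hz₁' hz₂ hz₂'
  -- the lower bound: the same constants (reversed roles)
  obtain ⟨I1, I2, I3, I4, ok1, okZm, okZ0, -, -, -, -⟩ := bounds_of_trudgianCheck hcheck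
  have e1 : ((11100 : ℕ) : ℝ) / 10 ^ 4 = 111 / 100 := by norm_num
  have e2 : ((300000 : ℕ) : ℝ) / 10 ^ 4 = 30 := by norm_num
  have e3 : ((12500 : ℕ) : ℝ) / 10 ^ 4 = 5 / 4 := by norm_num
  have e4 : ((25000 : ℕ) : ℝ) / 10 ^ 4 = 5 / 2 := by norm_num
  have e5 : ((20000 : ℕ) : ℝ) / 10 ^ 4 = 2 := by norm_num
  have e6 : ((40000 : ℕ) : ℝ) / 10 ^ 4 = 4 := by norm_num
  have e7 : ((12498 : ℕ) : ℝ) / 10 ^ 4 = 5 / 4 - 1 / 5000 := by norm_num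
  rw [e1, e2] at I1; rw [e3, e4] at I2; rw [e3, e5] at I3; rw [e6, e2] at I4
  have G : Real.log ‖riemannZeta (((111 / 100 : ℝ)) : ℂ)‖ ≤ 2.2696563886 := by
    have := ok1.2; simp only at this; rw [e1] at this
    refine this.trans ?_; norm_num
  have GZm : Real.log ‖riemannZeta (((5 / 4 - 1 / 5000 : ℝ)) : ℂ)‖ ≤ 1.5256867400 := by
    have := okZm.2; simp only at this; rw [e7] at this
    refine this.trans ?_; norm_num
  have GZ0 : (1.5249930917 : ℝ) ≤ Real.log ‖riemannZeta (((5 / 4 : ℝ)) : ℂ)‖ := by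
    rw [e3] at okZ0; refine le_trans ?_ okZ0; norm_num
  have hTB1 : ((TB1 : ℚ) : ℝ) = 1.4420089683 := by norm_num [TB1]
  have hTB2 : ((TB2 : ℚ) : ℝ) = 0.8393389420 := by norm_num [TB2]
  have hTB3 : ((TB3 : ℚ) : ℝ) = 0.6470996291 := by norm_num [TB3]
  have hTB4 : ((TB4 : ℚ) : ℝ) = 0.1050705446 := by norm_num [TB4]
  rw [hTB1] at I1; rw [hTB2] at I2; rw [hTB3] at I3; rw [hTB4] at I4
  have hA1 := dirichletA₁_le I1 G
  have hA2 := dirichletA₂_le I2 I3 I4 GZm GZ0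
  have hBc := dirichletB_le
  have hmain := neg_pi_mul_integral_lfunctionArgS_pair_le hq hχ (c := 111 / 100) (d := 3 / 4)
    (t₀ := 50) (by norm_num) (by norm_num) (by norm_num) (by norm_num) (by norm_num) h01 h12
    hz₁ hz₁' hz₂ hz₂'
  have hq2 : (2 : ℝ) ≤ q := by exact_mod_cast hq
  have hL : 0 ≤ Real.log (q * t₂ / (2 * π)) := by
    refine Real.log_nonneg ?_
    rw [le_div_iff₀ (by positivity)]
    nlinarith [Real.pi_lt_d6]
  have hπ := Real.pi_gt_d6
  set S := (∫ t in t₁..t₂, lfunctionArgS χ t) + ∫ t in t₁..t₂, lfunctionArgS χ⁻¹ t with hS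
  set L := Real.log (q * t₂ / (2 * π)) with hLdef
  have h1 : -(π * S) ≤ 2 * (2.826642 + 4.266146) + 2 * 0.2016703 * L := by
    have := mul_le_mul_of_nonneg_right hBc hL
    linarith
  have hlo : -S ≤ 2 * (2.26 + 0.0642 * L) := by
    by_contra hcon
    rw [not_le] at hcon
    have : π * (2 * (2.26 + 0.0642 * L)) < π * (-S) := mul_lt_mul_of_pos_left hcon Real.pi_pos
    nlinarith
  exact abs_le.2 ⟨by linarith, hup⟩

end TuringDirichlet

end Literature.NumberTheory.LFunctions

end
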